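import Summits.ResolutionOfSingularities.ResolutionOfSingularities.Theorems.FrobeniusLadderFInjectiveMacaulayficationCIClassRowEqualSupport
import Summits.ResolutionOfSingularities.ResolutionOfSingularities.Theorems.FrobeniusLadderFInjectiveMacaulayficationDiagonalCIPair
import Mathlib.Algebra.MvPolynomial.Division
import HarnessLib

/-!
# (U-Π) ★★★ THE CI CLASS ROW FOR ARBITRARY SUPPORTS, UNCONDITIONALLY: the PRODUCT TRICK — the toric data of ✓ `F108Consumable_holds` for the PRODUCT `∏ F_l` serve every member
# (crux `FInjectiveMacaulayfication` stmt-ResolutionOfSingularities-15315, chain w45a; res-L1-w45a-plan-1 RULINGs R23.25 (β) / R23.29 «(Π) CIClassRowProduct = factor lemma + product-trick class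
# row, cured column WITHOUT a kit job via ✓F108Consumable tables»; seat res-L1-w45a-stub-2 g13)

[OURS · L1 W4.5a] Support file (`--supports stmt-ResolutionOfSingularities-15315 --as helper`); def-free; UNCONDITIONAL; no named fact, no sorry; NOT a statement of any manuscript;
replaces the role of NO printed item. Nothing of the crux is proved. AI-written (AI review weaker than expert review).

THE TRICK. The Newton polyhedron of a product is the Minkowski sum of the Newton polyhedra, so its dual fan refines the dual fan of every factor: a toric chart on which the total
transform of `∏ F_l` is «a monomial times a unit-constant polynomial» does the same to every `F_l`. Algebraically (§1): in `R[Y]`, `R` a domain, if `f·g = Y^d·h` with `h(0) ≠ 0`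
then `f = Y^{d₁}·f₁` with `f₁(0) ≠ 0` (induction on `|d|`, peeling one variable `Yᵢ ∣ Y^d` at a time with `Yᵢ` PRIME — ✓`MvPolynomial.X_dvd_mul_iff`). Hence (§2) the tables of
✓`F108ClassRow.F108Consumable_holds k n (∏ F_l)` (the product only has to be CONVENIENT) feed ✓`CIClassRow.fHalfRow_CI_of_tables` for ANY tuple — equal supports (✓`CIClassRowEqualSupport`)
were never needed:
* §1 `exists_eq_monomial_mul_of_mul_eq` (pair), `exists_eq_monomial_mul_of_prod_eq` (finite products);
* §2 ★★★ `fHalfRow_CI_of_convenientProduct` — `k` ANY field of characteristic `p`, `K ⊇ k` algebraically closed; `F₀..F_{r−1} ∈ k[X]` (`n ≥ 1`) with CONVENIENT PRODUCT, generating a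
  PRIME ideal, GEOMETRICALLY CI-Newton-non-degenerate along every positive weight, `x̄ᵢ ≠ 0`, `X = V(F)` regular off the origin `v`: for EVERY blowing up of `Spec 𝒪_{X,v}` along the POINT
  FLOOR there is `𝓚 ≠ ⊥` supported over the closed point all of whose blowings up are FULL at every stalk — UNCONDITIONAL;
* §3 `coeff_single_diag_mul_diag`, `convenient_diag_mul_diag` — the product of a diagonal pair `(Σ cᵢxᵢ^{aᵢ}, Σ dᵢxᵢ^{bᵢ})` is convenient (coefficient `cⱼdⱼ` at `xⱼ^{aⱼ+bⱼ}`), whatever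
  the exponent vectors `a, b ≥ 1` — the door for the UNEQUAL-SUPPORT beds (BED CI-3, ✓`TwoRatioDiagonalPair`).
[cite: IshiiSingularities2018, Thm. 4.4.23 and Cor. 4.4.25] [cite: CuetoPopescupampuStepanov2023, Def. 4.2 and §4] [cite: StacksProject, Tag 080A]
-/

-- single-problem summit: the doubled namespace component is forced
set_option linter.dupNamespace false

noncomputable section

open AlgebraicGeometry CategoryTheory Literature.AlgebraicGeometry.Resolution TopologicalSpace IsLocalRing MvPolynomial

namespace Summit.ResolutionOfSingularities.ResolutionOfSingularities.Theorems.FInjectiveMacaulayfication.CIClassRowProduct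

open Summit.ResolutionOfSingularities.ResolutionOfSingularities.Theorems.FInjectiveMacaulayfication
open Literature.AlgebraicGeometry.Resolution.BoubakriGreuelMarkwig CINondegenerate SliceableCentre

/-! ## §1 The factor lemma: a factor of «monomial × unit-constant» is «monomial × unit-constant» -/

/-- `Y^{d′ + eᵢ} = Yᵢ · Y^{d′}` (coefficient `1`). [plumbing] -/
theorem monomial_add_single_one {σ : Type} {R : Type} [CommSemiring R] (d' : σ →₀ ℕ) (i : σ) :
    (monomial (d' + Finsupp.single i 1) (1 : R) : MvPolynomial σ R) = X i * monomial d' 1 := by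
  rw [← pow_one (X i : MvPolynomial σ R), X_pow_eq_monomial, monomial_mul, one_mul, add_comm]

/-- THE FACTOR LEMMA, graded form: if `f·g = Y^d·h` in `R[Y]` (`R` a domain) with `h(0) ≠ 0` and `|d| = N`, then `f = Y^{d₁}·f₁` with `f₁(0) ≠ 0`. Induction on `N`: peel a variable
`Yᵢ ∣ Y^d`, which is prime (✓`MvPolynomial.X_dvd_mul_iff`), off `f` or off `g`. [folklore] -/
theorem exists_eq_monomial_mul_aux {σ : Type} {R : Type} [CommRing R] [IsDomain R] :
    ∀ (N : ℕ) (d : σ →₀ ℕ), d.degree = N → ∀ f g h : MvPolynomial σ R, f * g = monomial d 1 * h → constantCoeff h ≠ 0 →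
      ∃ (d₁ : σ →₀ ℕ) (f₁ : MvPolynomial σ R), f = monomial d₁ 1 * f₁ ∧ constantCoeff f₁ ≠ 0 := by
  classical
  intro N
  induction N with
  | zero =>
    intro d hd f g h hfg hh
    have hd0 : d = 0 := (Finsupp.degree_eq_zero_iff d).mp hd
    subst hd0
    refine ⟨0, f, by rw [monomial_zero', C_1, one_mul], fun hf => hh ?_⟩
    have hc := congrArg constantCoeff hfg
    rw [map_mul, hf, zero_mul, map_mul, monomial_zero', C_1, map_one, one_mul] at hc
    exact hc.symm
  | succ N ih =>
    intro d hd f g h hfg hh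
    have hdne : d ≠ 0 := fun h0 => by rw [h0, map_zero] at hd; exact Nat.succ_ne_zero N hd.symm
    obtain ⟨i, hi⟩ := Finsupp.support_nonempty_iff.mpr hdne
    have hdi : 1 ≤ d i := Nat.one_le_iff_ne_zero.mpr (Finsupp.mem_support_iff.mp hi)
    obtain ⟨d', hdd'⟩ : ∃ d' : σ →₀ ℕ, d = d' + Finsupp.single i 1 :=
      ⟨d - Finsupp.single i 1, by rw [tsub_add_cancel_of_le (Finsupp.single_le_iff.mpr (by simpa using hdi))]⟩
    have hdeg : d'.degree = N := by
      have h1 := congrArg Finsupp.degree hdd'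
      rw [map_add, Finsupp.degree_single, hd] at h1
      omega
    rw [hdd', monomial_add_single_one, mul_assoc] at hfg
    have hdvd : X i ∣ f * g := ⟨monomial d' 1 * h, hfg⟩
    rcases X_dvd_mul_iff.mp hdvd with ⟨f', hf'⟩ | ⟨g', hg'⟩
    · rw [hf', mul_assoc, X_mul_cancel_left_iff] at hfg
      obtain ⟨d₁, f₁, hf₁, hf₁0⟩ := ih d' hdeg f' g h hfg hh
      exact ⟨d₁ + Finsupp.single i 1, f₁, by rw [hf', hf₁, ← mul_assoc, ← monomial_add_single_one], hf₁0⟩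
    · rw [hg', mul_left_comm, X_mul_cancel_left_iff] at hfg
      exact ih d' hdeg f g' h hfg hh

/-- ★ **THE FACTOR LEMMA**: if `f·g = Y^d·h` in `R[Y]` (`R` a domain) with `h(0) ≠ 0`, then `f = Y^{d₁}·f₁` with `f₁(0) ≠ 0`. [folklore] -/
theorem exists_eq_monomial_mul_of_mul_eq {σ : Type} {R : Type} [CommRing R] [IsDomain R] (f g h : MvPolynomial σ R) (d : σ →₀ ℕ)
    (hfg : f * g = monomial d 1 * h) (hh : constantCoeff h ≠ 0) :
    ∃ (d₁ : σ →₀ ℕ) (f₁ : MvPolynomial σ R), f = monomial d₁ 1 * f₁ ∧ constantCoeff f₁ ≠ 0 :=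
  exists_eq_monomial_mul_aux _ d rfl f g h hfg hh

/-- ★ The factor lemma for FINITE PRODUCTS: if `∏_l f_l = Y^d·h` with `h(0) ≠ 0`, every `f_l = Y^{d_l}·g_l` with `g_l(0) ≠ 0`. [folklore] -/
theorem exists_eq_monomial_mul_of_prod_eq {σ : Type} {R : Type} [CommRing R] [IsDomain R] {ι : Type} [Fintype ι] [DecidableEq ι]
    (f : ι → MvPolynomial σ R) (h : MvPolynomial σ R) (d : σ →₀ ℕ) (hprod : ∏ l, f l = monomial d 1 * h) (hh : constantCoeff h ≠ 0) (l : ι) :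
    ∃ (d₁ : σ →₀ ℕ) (f₁ : MvPolynomial σ R), f l = monomial d₁ 1 * f₁ ∧ constantCoeff f₁ ≠ 0 :=
  exists_eq_monomial_mul_of_mul_eq (f l) (∏ l' ∈ Finset.univ.erase l, f l') h d (by rw [Finset.mul_prod_erase _ _ (Finset.mem_univ l), hprod]) hh

/-! ## §2 ★★★ The CI class row for tuples with convenient product, unconditionally -/

set_option maxHeartbeats 800000 in
-- unpacking the interface + one `choose`
/-- ★★★ **THE CI CLASS ROW FOR ARBITRARY SUPPORTS, ANY FIELD OF CHARACTERISTIC `p`, UNCONDITIONAL (product trick).** `k` ANY field of characteristic `p`, `K ⊇ k` algebraically closed;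
`F₀..F_{r−1} ∈ k[X_0..X_{n−1}]` (`n ≥ 1`) whose PRODUCT is CONVENIENT, generating a PRIME ideal, GEOMETRICALLY CI-Newton-non-degenerate along every positive weight, `x̄ᵢ ≠ 0`,
`X = Spec k[X]/(F)` regular off the origin `v`. THEN for EVERY blowing up `g : S′ → Spec 𝒪_{X,v}` along the POINT FLOOR there is `𝓚 ≠ ⊥` on `S′`, supported over the closed point,
all of whose blowings up are FULL AT EVERY STALK. Tables: ✓`F108ClassRow.F108Consumable_holds k n (∏ F_l)`; per member by §1; then ✓`CIClassRow.fHalfRow_CI_of_tables`.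
[OURS · class theorem, unconditional; cite: IshiiSingularities2018, Thm. 4.4.23 and Cor. 4.4.25; CuetoPopescupampuStepanov2023, Def. 4.2; StacksProject, Tag 080A] -/
theorem fHalfRow_CI_of_convenientProduct (p : ℕ) [Fact p.Prime] (k : Type) [Field k] [CharP k p] (K : Type) [Field K] [Algebra k K] [IsAlgClosed K]
    {n r : ℕ} (hn : 0 < n) (Fs : Fin r → MvPolynomial (Fin n) k) (hprime : (Ideal.span (Set.range Fs)).IsPrime)
    (hconv : ∀ j : Fin n, ∃ N : ℕ, 0 < N ∧ MvPolynomial.coeff (Finsupp.single j N) (∏ l, Fs l) ≠ 0)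
    (hND : ∀ w : Fin n → ℝ, (∀ i, 0 < w i) →
      IsCINondegenerateAlong w (fun l => ((map (algebraMap k K) (Fs l) : MvPolynomial (Fin n) K) : MvPowerSeries (Fin n) K)))
    (hXne : ∀ v : Fin n, Ideal.Quotient.mk (Ideal.span (Set.range Fs)) (X v) ≠ 0)
    (hreg : ∀ x : Spec (.of (MvPolynomial (Fin n) k ⧸ Ideal.span (Set.range Fs))),
      ¬ Ideal.span (Set.range fun j : Fin n => Ideal.Quotient.mk (Ideal.span (Set.range Fs)) (X j)) ≤ x.asIdeal → IsRegularLocalRing (Localization.AtPrime x.asIdeal))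
    (v : Spec (.of (MvPolynomial (Fin n) k ⧸ Ideal.span (Set.range Fs))))
    (hvm : v.asIdeal = Ideal.span (Set.range fun j : Fin n => Ideal.Quotient.mk (Ideal.span (Set.range Fs)) (X j))) :
    ∀ (S' : Scheme.{0}) (gS : S' ⟶ Spec ((Spec (.of (MvPolynomial (Fin n) k ⧸ Ideal.span (Set.range Fs)))).presheaf.stalk v)),
      IsBlowup gS ((affineBlowup.idealSheaf (Ideal.span (Set.range fun j : Fin n => Ideal.Quotient.mk (Ideal.span (Set.range Fs)) (X j)))).comap
        ((Spec (.of (MvPolynomial (Fin n) k ⧸ Ideal.span (Set.range Fs)))).fromSpecStalk v)) →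
      ∃ 𝓚 : S'.IdealSheafData, 𝓚 ≠ ⊥ ∧
        (∀ s ∈ (𝓚.support : Set S'), gS.base s = closedPoint ((Spec (.of (MvPolynomial (Fin n) k ⧸ Ideal.span (Set.range Fs)))).presheaf.stalk v)) ∧
        ∀ (S'' : Scheme.{0}) (π : S'' ⟶ S'), IsBlowup π 𝓚 → ∀ s : S'', FullCl p (S''.presheaf.stalk s) := by
  classical
  obtain ⟨A, KA, t, m, V, a, g, d, hIA, hKprim, hprim, hAJ, hcov, hV, haA, hgen, hge, hθ, hg0, hm⟩ := F108ClassRow.F108Consumable_holds k n (∏ l, Fs l) hconv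
  have hex : ∀ (c : Fin t) (l : Fin r), ∃ (e : Fin n →₀ ℕ) (g' : MvPolynomial (Fin n) k),
      aeval (fun j : Fin n => ∏ i : Fin n, (X i : MvPolynomial (Fin n) k) ^ V c i j) (Fs l) = monomial e 1 * g' ∧ constantCoeff g' ≠ 0 := by
    intro c l
    refine exists_eq_monomial_mul_of_prod_eq (fun l => aeval (fun j : Fin n => ∏ i : Fin n, (X i : MvPolynomial (Fin n) k) ^ V c i j) (Fs l)) (g c) (d c) ?_ (hg0 c) l
    rw [← map_prod]
    exact hθ c
  choose e gs hgs using hex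
  have hv : ∀ c : Fin t, Ideal.Quotient.mk (Ideal.span (Set.range Fs)) (monomial (m c) (1 : k)) ∈
      Ideal.span ((fun e : Fin n →₀ ℕ => Ideal.Quotient.mk (Ideal.span (Set.range Fs)) (monomial e (1 : k))) '' (A : Set (Fin n →₀ ℕ))) :=
    fun c => Ideal.subset_span ⟨m c, hm c, rfl⟩
  exact CIClassRow.fHalfRow_CI_of_tables p k K hn Fs hprime hND hXne hreg A KA (F108ClassRow.span_quotient_eq_mul k _ A KA hIA) hKprim hprim hAJ t m hcov V hV a haA hgen hge
    gs e (fun c l => (hgs c l).1) (fun c l => (hgs c l).2) hv v hvm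

/-! ## §3 Diagonal pairs have convenient products -/

/-- The coefficient of `xⱼ^{aⱼ+bⱼ}` in `(Σ cᵢxᵢ^{aᵢ})·(Σ dᵢxᵢ^{bᵢ})` is `cⱼdⱼ` (`aᵢ, bᵢ ≥ 1`). [folklore] -/
theorem coeff_single_diag_mul_diag {K' : Type} [Field K'] {n : ℕ} (a b : Fin n → ℕ) (ha : ∀ i, a i ≠ 0) (hb : ∀ i, b i ≠ 0) (c d : Fin n → K') (j : Fin n) :
    coeff (Finsupp.single j (a j + b j)) ((∑ i : Fin n, monomial (Finsupp.single i (a i)) (c i)) * ∑ i : Fin n, monomial (Finsupp.single i (b i)) (d i)) =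
      c j * d j := by
  classical
  rw [coeff_mul, Finset.sum_eq_single (Finsupp.single j (a j), Finsupp.single j (b j))]
  · rw [DiagonalCIPair.coeff_diag_single a ha c j, DiagonalCIPair.coeff_diag_single b hb d j]
  · intro x hx hne
    rw [Finset.HasAntidiagonal.mem_antidiagonal] at hx
    by_cases h1 : ∀ i, Finsupp.single i (a i) ≠ x.1
    · rw [DiagonalCIPair.coeff_diag_eq_zero a c x.1 h1, zero_mul]
    · push Not at h1
      obtain ⟨i, hi⟩ := h1
      exfalso
      apply hne
      have hij : i = j := by
        by_contra hij
        have h1 : (x.1 + x.2) i = (Finsupp.single j (a j + b j)) i := by rw [hx]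
        rw [Finsupp.add_apply, ← hi, Finsupp.single_eq_same, Finsupp.single_apply, if_neg (Ne.symm hij)] at h1
        exact ha i (Nat.eq_zero_of_add_eq_zero_right h1)
      subst hij
      have h2 : x.2 = Finsupp.single i (b i) := by
        have h := hx
        rw [← hi, Finsupp.single_add] at h
        exact add_left_cancel h
      exact Prod.ext hi.symm h2
  · intro h
    exact (h (by rw [Finset.HasAntidiagonal.mem_antidiagonal, Finsupp.single_add])).elim

/-- ★ **THE PRODUCT OF A DIAGONAL PAIR IS CONVENIENT** (all `cᵢ, dᵢ ≠ 0`, `aᵢ, bᵢ ≥ 1`), whatever the two exponent vectors. [folklore] -/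
theorem convenient_diag_mul_diag {K' : Type} [Field K'] {n : ℕ} (a b : Fin n → ℕ) (ha : ∀ i, a i ≠ 0) (hb : ∀ i, b i ≠ 0) (c d : Fin n → K')
    (hc : ∀ i, c i ≠ 0) (hd : ∀ i, d i ≠ 0) (F : Fin 2 → MvPolynomial (Fin n) K')
    (hF0 : F 0 = ∑ i : Fin n, monomial (Finsupp.single i (a i)) (c i)) (hF1 : F 1 = ∑ i : Fin n, monomial (Finsupp.single i (b i)) (d i)) :
    ∀ j : Fin n, ∃ N : ℕ, 0 < N ∧ MvPolynomial.coeff (Finsupp.single j N) (∏ l, F l) ≠ 0 := fun j =>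
  ⟨a j + b j, by have := ha j; omega, by
    rw [Fin.prod_univ_two, hF0, hF1, coeff_single_diag_mul_diag a b ha hb c d j]
    exact mul_ne_zero (hc j) (hd j)⟩

end Summit.ResolutionOfSingularities.ResolutionOfSingularities.Theorems.FInjectiveMacaulayfication.CIClassRowProduct

end
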